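import Summits.RiemannHypothesis.RiemannHypothesis.Theses.SignCone
import Summits.RiemannHypothesis.RiemannHypothesis.Theorems.ConeMagnification.Negative.LoadBearing
import Summits.RiemannHypothesis.RiemannHypothesis.Theorems.ConeMagnification.Negative.SlackBall
import Summits.RiemannHypothesis.RiemannHypothesis.Theorems.SignConeConeMagnificationCompactness

/-!
# Disproof of `ConeMagnification` (crux stmt-RiemannHypothesis-16303, route `SignCone`) — findings

Workfile of the crux disprover (seat `refuter-cdisprove-stmt-RiemannHypothesis-16303-0`, cycle 1).
The crux is `Hyp → RH`, `Hyp` = "at every cutoff `a > 0` some weight `c ≥ 0`, `c 1 = 0`, has fake Weil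
form `W_ar - P_c ≥ -‖g‖₂²` on the Weil tests supported in `[-a, a]`". VERDICT OF THIS CYCLE: NO KILL,
and none is possible short of `¬RH` (§A). What the cycle establishes instead (all kernel-checked facts
live in the landed support files `Theorems/ConeMagnification/Negative/LoadBearing.lean` (p130369) and
`…/Negative/SlackBall.lean` (p130627), namespace `…Theorems.ConeMagnification.Negative`, re-exported below
under the protocol names):

* §A LOAD-BEARING MAP. `¬ ConeMagnification ↔ Hyp ∧ ¬RH` and `RH → Hyp` (`c = Λ`), so a refutation IS a
  disproof of RH (`coneMagnification_not_iff`, `…_hyp_of_riemannHypothesis`); given the proved sibling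
  `SignConeDuality`, `¬ ConeMagnification ↔ SignConeInequality ∧ ¬RH`. The two quantitative features of
  `Hyp` are each load-bearing in the only sense available for a statement implied by RH — delete them
  and the antecedent becomes a THEOREM, so the weakened crux is RH itself:
  - all cutoffs: `Dual a` is unconditional for `a ≤ 563/1024` (`c = log 2·𝟙{n=2}`, first-prime
    certificate) ⇒ `coneMagnification_false_without_allCutoffs` below;
  - uniform unit slack: with cutoff-dependent slack `C(a)‖g‖₂²` the inequality is unconditional with
    `c = Λ` (Bombieri 2000 §4 a-priori bound) ⇒ `coneMagnification_false_without_uniformSlack` below.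
  Decorations (information for provers): `c 1 = 0` (a positive `c 1` only subtracts `2 c(1) ‖g‖₂²`),
  `c 0` (the `n = 0` term is `c 0 / √0 · … = 0`), single autocorrelations vs finite sums (everything is
  linear in `G = g ⋆ g̃` and `‖g‖₂² = G 0`); `0 ≤ c n` is NOT decoration (it is the Landau hypothesis and
  the one-sided a-priori bound behind `exists_uniform_fakeWeight`).
* §B/§C THE UNIT-SLACK CONE UNDER RH (tightness + refuted strengthenings of the 2001 W-MAG plan, whose
  Lean spine in the tree is `coneMagnification_iff_uniform` + `riemannHypothesis_of_fakeWeight_landau`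
  with open inputs (hcont) continuation of `D_c - 1/(s-1)` and (hdef) `Σ (Λ-c)₊ n^{-σ} < ∞`, `σ > 1/2`):
  - `Λ - η𝟙{n=p}` is in the UNIFORM cone whenever `2η ≤ √p` (`|G| ≤ ‖g‖₂²`); so the cone is NOT rigid
    (the prime 2 can be deleted outright: `2 log 2 ≤ √2`) — contrary to the exact cone (`K = {Λ}`,
    W-COMP/W-SRPP) and contrary to a remark in the previous crux-attack note that unit slack pins `c(2)`
    (its `2 log 2/(√2-1) = 3.35 > 1` is the EXCESS direction; the deficit direction costs only
    `2 log 2/(√2+1) = 0.57 < 1`); and the prime deficit `Σ (Λ-c)₊/√n` attains `1/2` (p = 7, η = √7/2),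
    so any deficit stub with constant `< 1/2` is false under RH. W-MAG Thm 1.2(i) ("`≤ 2M`") survives.
    More generally (`SlackBall.lean`) the whole ball `{Λ + m : m finitely supported, Σ|m(n)|/√n ≤ 1/2}` is
    in the uniform cone: weights with fake prime powers at COMPOSITES (`Λ + (√6/2)𝟙{n=6}`), weights
    above `Λ`, weights vanishing at small primes — so "supported on prime powers", "`c ≤ Λ`", and the 2001
    one-sided Hypothesis P read for the slack cone are all false under RH.
  - CRUX IDEAS CROSS-CHECK (cards `landau-pinch`, `resonant-positive-witness`,
    `forced-resonance-universality`, all written before this file existed): none is hit by these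
    refutations — `AbscissaAsymmetry`/`WindowedDeficit` concern INFINITE-support behaviour (`σ > 1/2`
    summability, windowed deficit `≪ x^ε`), which the finitely supported cone members above satisfy
    trivially, and the prediction below (prime variation `≤ 1`) SUPPORTS the deficit disjunct of
    `landau-pinch` and the lossy `WindowedDeficit`. What the cards must not assume: any rigidity or sign
    pattern of `c - Λ` at individual integers (dead by `SlackBall`), any deficit constant `< 1/2`.
  - HEURISTIC CONVERSE (the `K`-criterion, §C docstrings): for a finitely supported modification
    `m = c - Λ` the cone condition is `sup_θ Σₙ m(n) n^{-1/2} cos⟨v(n),θ⟩ ≤ 1/2` over the torus of prime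
    phases (spectral form `W_c(G) + ‖g‖₂² = (1/2π)∫|ĝ|² K_c`, `K_c = 1 + 2πΣ_γ δ_γ - 2 Re M(1/2+it)`,
    necessity via long tests parked in zero gaps at Kronecker heights). It predicts `1/2` sharp for
    prime-supported deficits and kills every block redistribution "`Λ ↦ 1` on `[P, 2P]`" (mean square of
    the block polynomial `≈ 0.69 log P > 1/4`). Not formalised: `slackCone_sub_single_only_if` is sorried.
  - PREDICTION with a dual certificate (`slackCone_prime_variation_le_one`, sorried): integrating the
    torus criterion against the diagonal Fejér measure kills every composite and prime-power term and
    leaves `Σ_p |c(p) - log p|/√p ≤ 1` — the W-MAG deficit bound with constant `1` (we show `≥ 1/2` is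
    needed), hence (hdef) for all `σ > 1/2`. The obstruction to rigour is located precisely (Kronecker
    heights vs. test length vs. visibility), which is presumably what 2001's "resonator/type inequality"
    overcomes; a multiplicative resonator is suggested as the arithmetic stand-in for the diagonal measure.
* §D ADVERSARIAL WEIGHTS UNDER ¬RH (why the crux resists; docstring catalogue `adversarialWeights_note`):
  twisted `Λ(1+cos(γ₀ log n))` dies on one-bump resonant tests (fake pole at `1+iγ₀`); quartet-cancelling
  `Λ + n^{ρ₀-1}+…` is negative at composites, and its positive repair `Λ + (n^{β₀-1}+n^{-β₀})(A+2cos(γ₀log n))`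
  plants real anti-zeros at `β₀, 1-β₀` seen by same-sign two-bump tests (`~ -e^{(β₀-1/2)T}`), while the
  mean-corrected version `Λ(1 + 2n^{β₀-1}cos(γ₀ log n))` plants fake zeros at `Re s = β₀ - 1/2 < 1/2`
  magnifiable at rate `e^{(1-β₀)T}`; `Λ+ε`, `(1-ε)Λ+ε`, `c ≡ 1`, squares: wrong residue at `1` or `K_c < 0`
  (previous seat, job j020144). Every cheap adversary dies by the same mechanism the 2001 proof invokes
  (nonnegativity ⇒ a real singularity / a mean-square excess on the critical line) — consistent with
  W-MAG, not a proof of it. (hcont) has a clean classical route (Bochner–Schwartz: `T_c + δ₀` is a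
  positive-definite distribution, hence tempered, hence `D_c(s) - 1/(s-1) = 1/s + Arch(s) - ∫dμ_c(t)/(s-1/2-it)`
  analytic on `Re s > 1/2`); (hdef) is the genuinely unpublished step ("resonator/type inequality"):
  the naive Bohr/Kronecker argument for `Σ_{p≤N}(log p - c(p))₊/√p = O(1)` FAILS because positivity over
  the zeros forces tests of length `≳ log t₀` at Kronecker heights `t₀`, which see composites up to
  `t₀^{O(1)}` where the adversary's excess interferes — so provers should expect (hdef) only for `σ > 1/2`
  (which is all `riemannHypothesis_of_fakeWeight_landau` needs), not a uniform `O(1)` bound.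
* §E TARGETS: none yet (no line picked, `stuck_stubs = []`).
-/

noncomputable section

set_option linter.dupNamespace false

open scoped BigOperators ArithmeticFunction.vonMangoldt ComplexConjugate
open MeasureTheory Set Literature.NumberTheory.LFunctions
open Summit.RiemannHypothesis.RiemannHypothesis.Theses.SignCone
open Summit.RiemannHypothesis.RiemannHypothesis.Theorems.ConeMagnification

namespace Summit.RiemannHypothesis.RiemannHypothesis.Cruxes.ConeMagnification.Disproof

/-! ## §A Load-bearing analysis

The crux has ONE hypothesis `Hyp`; every weakening `Hyp'` of it gives a crux `Hyp' → RH` that is still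
implied by RH, so no `¬(Hyp' → RH)` is provable short of `¬RH`. The protocol's `_false_without_<H>`
theorems are therefore replaced by `…_iff_riemannHypothesis` theorems: "with `<H>` deleted the crux IS the
summit" (its antecedent being a theorem). -/

/-- The crux with the cutoff quantifier bounded (`0 < a ≤ 563/1024` instead of all `a > 0`). -/
def ConeMagnificationWithoutAllCutoffs : Prop :=
  (∀ a : ℝ, 0 < a → a ≤ 563 / 1024 → ∃ c : ℕ → ℝ, (∀ n, 0 ≤ c n) ∧ c 1 = 0 ∧ ∀ g : ℝ → ℂ, (ContDiff ℝ ((⊤ : ℕ∞) : WithTop ℕ∞) g ∧ HasCompactSupport g) → tsupport g ⊆ Set.Icc (-a) a → let G : ℝ → ℂ := MeasureTheory.convolution g (fun u => (starRingEnd ℂ) (g (-u))) (ContinuousLinearMap.mul ℂ ℂ) MeasureTheory.MeasureSpace.volume; let M : ℂ → ℂ := fun s => ∫ u : ℝ, G u * Complex.exp ((s - 1 / 2) * u); -(∫ t, ‖g t‖ ^ 2) ≤ (M 0 + M 1 + ((1 / (2 * Real.pi) : ℂ) * (∫ t : ℝ, M (1 / 2 + t * Complex.I) * ((Complex.digamma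 (1 / 4 + t / 2 * Complex.I)).re : ℂ)) - G 0 * (Real.log Real.pi : ℂ)) - ∑' n : ℕ, ((c n : ℝ) : ℂ) / (Real.sqrt n : ℂ) * (G (Real.log n) + G (-Real.log n))).re) →
    Summit.RiemannHypothesis

/-- **"All cutoffs" is load-bearing**: the bounded-cutoff crux is equivalent to RH (its antecedent is
the theorem `Negative.coneMagnification_dual_of_le_certb`, weight `log 2 · 𝟙{n = 2}`). [folklore] -/
theorem coneMagnification_false_without_allCutoffs :
    ConeMagnificationWithoutAllCutoffs ↔ Summit.RiemannHypothesis :=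
  Negative.coneMagnification_boundedCutoff_iff_riemannHypothesis

/-- The crux with the unit slack replaced by a cutoff-dependent slack `C(a) ‖g‖₂²`. -/
def ConeMagnificationWithoutUniformSlack : Prop :=
  (∀ a : ℝ, 0 < a → ∃ C : ℝ, ∃ c : ℕ → ℝ, (∀ n, 0 ≤ c n) ∧ c 1 = 0 ∧ ∀ g : ℝ → ℂ, (ContDiff ℝ ((⊤ : ℕ∞) : WithTop ℕ∞) g ∧ HasCompactSupport g) → tsupport g ⊆ Set.Icc (-a) a → let G : ℝ → ℂ := MeasureTheory.convolution g (fun u => (starRingEnd ℂ) (g (-u))) (ContinuousLinearMap.mul ℂ ℂ) MeasureTheory.MeasureSpace.volume; let M : ℂ → ℂ := fun s => ∫ u : ℝ, G u * Complex.exp ((s - 1 / 2) * u); -(C * ∫ t, ‖g t‖ ^ 2) ≤ (M 0 + M 1 + ((1 / (2 * Real.pi) : ℂ) * (∫ t : ℝ, M (1 / 2 + t * Complex.I) * ((Complex.digamma (1 / 4 + t / 2 * Complex.I)).re : ℂ)) - G 0 * (Real.log Real.pi : ℂ)) - ∑' n : ℕ, ((c n : ℝ) : ℂ) / (Real.sqrt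 n : ℂ) * (G (Real.log n) + G (-Real.log n))).re) →
    Summit.RiemannHypothesis

/-- **"Uniform unit slack" is load-bearing**: the cutoff-dependent-slack crux is equivalent to RH (its
antecedent is the theorem `Negative.coneMagnification_dualSlack`, weight `Λ`, Bombieri's constant
`C(a) = 2(sinh a - a) + 2Σ_{n≤e^{2a}} Λ(n)/√n - Re ψ(1/4) + log π`). [folklore] -/
theorem coneMagnification_false_without_uniformSlack :
    ConeMagnificationWithoutUniformSlack ↔ Summit.RiemannHypothesis :=
  Negative.coneMagnification_cutoffSlack_iff_riemannHypothesis

/-- **Irrefutability**: `¬ ConeMagnification ↔ Hyp ∧ ¬RH` (re-export). With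
`Negative.coneMagnification_hyp_of_riemannHypothesis : RH → Hyp` this says the crux is equivalent to
`Hyp ↔ RH`, and that every refutation contains a disproof of RH. [folklore] -/
theorem coneMagnification_not_iff :
    ¬ ConeMagnification ↔
      ((∀ a : ℝ, 0 < a → ∃ c : ℕ → ℝ, (∀ n, 0 ≤ c n) ∧ c 1 = 0 ∧ ∀ g : ℝ → ℂ, (ContDiff ℝ ((⊤ : ℕ∞) : WithTop ℕ∞) g ∧ HasCompactSupport g) → tsupport g ⊆ Set.Icc (-a) a → let G : ℝ → ℂ := MeasureTheory.convolution g (fun u => (starRingEnd ℂ) (g (-u))) (ContinuousLinearMap.mul ℂ ℂ) MeasureTheory.MeasureSpace.volume; let M : ℂ → ℂ := fun s => ∫ u : ℝ, G u * Complex.exp ((s - 1 / 2) * u); -(∫ t, ‖g t‖ ^ 2) ≤ (M 0 + M 1 + ((1 / (2 * Real.pi) : ℂ) * (∫ t : ℝ, M (1 / 2 + t * Complex.I) * ((Complex.digamma (1 / 4 + t / 2 * Complex.I)).re : ℂ)) - G 0 * (Real.log Real.pi : ℂ)) - ∑' n : ℕ, ((c n : ℝ) : ℂ) / (Real.sqrt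 n : ℂ) * (G (Real.log n) + G (-Real.log n))).re) ∧
        ¬ Summit.RiemannHypothesis) :=
  Negative.coneMagnification_not_iff

/-- **Given `SignConeDuality` (proved: `SignConeDuality_of`, not co-importable here), the crux fails iff
the route target holds and the summit fails.** [folklore] -/
theorem coneMagnification_not_iff_signConeInequality (hD : SignConeDuality) :
    ¬ ConeMagnification ↔ (SignConeInequality ∧ ¬ Summit.RiemannHypothesis) :=
  Negative.coneMagnification_not_iff_signConeInequality hD

/-! ## §B Tightness: the prime deficit of a unit-slack cone weight reaches `1/2` (under RH) -/

/-- **Deficit `1/2` is attained** (re-export): under RH there is a weight in the UNIFORM unit-slack cone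
(`Λ - (√7/2)𝟙{n = 7}`) with `Σₙ (Λ(n) - c(n))₊/√n = 1/2`. Any stub "cone weight ⇒ deficit `< 1/2`"
(or "`= 0`") is false under RH; the 2001 bound `≤ 2M` (`M = 1`) is consistent. [folklore] -/
theorem coneMagnification_tight_at_deficit_half (hRH : Summit.RiemannHypothesis) :
    ∃ c : ℕ → ℝ, (∀ n, 0 ≤ c n) ∧ c 1 = 0 ∧
      (∀ g : ℝ → ℂ, (ContDiff ℝ ((⊤ : ℕ∞) : WithTop ℕ∞) g ∧ HasCompactSupport g) → let G : ℝ → ℂ := MeasureTheory.convolution g (fun u => (starRingEnd ℂ) (g (-u))) (ContinuousLinearMap.mul ℂ ℂ) MeasureTheory.MeasureSpace.volume; let M : ℂ → ℂ := fun s => ∫ u : ℝ, G u * Complex.exp ((s - 1 / 2) * u); -(∫ t, ‖g t‖ ^ 2) ≤ (M 0 + M 1 + ((1 / (2 * Real.pi) : ℂ) * (∫ t : ℝ, M (1 / 2 + t * Complex.I) * ((Complex.digamma (1 / 4 + t / 2 * Complex.I)).re : ℂ)) - G 0 * (Real.log Real.pi : ℂ)) - ∑' n : ℕ, ((c n : ℝ)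 : ℂ) / (Real.sqrt n : ℂ) * (G (Real.log n) + G (-Real.log n))).re) ∧
      (∑' n : ℕ, max (Λ n - c n) 0 / Real.sqrt n) = 1 / 2 :=
  Negative.coneMagnification_exists_slackCone_deficit_eq_half_of_riemannHypothesis hRH

/-! ## §C Refuted strengthenings of the magnification step (under RH), and the `K`-criterion -/

/-- **NOT rigid** (re-export): under RH, "every weight in the uniform unit-slack cone equals `Λ`" is
false — the prime `2` can be deleted (`Λ𝟙{n ≠ 2}` is in the cone since `2 log 2 ≤ √2`). The exact cone
(slack `0`) IS rigid (route item `ExactConeRigidity`, 2001 W-COMP/W-SRPP); unit slack buys a whole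
convex neighbourhood of `Λ`. [folklore] -/
theorem not_slackConeRigid (hRH : Summit.RiemannHypothesis) :
    ¬ (∀ c : ℕ → ℝ, (∀ n, 0 ≤ c n) → c 1 = 0 →
        (∀ g : ℝ → ℂ, (ContDiff ℝ ((⊤ : ℕ∞) : WithTop ℕ∞) g ∧ HasCompactSupport g) → let G : ℝ → ℂ := MeasureTheory.convolution g (fun u => (starRingEnd ℂ) (g (-u))) (ContinuousLinearMap.mul ℂ ℂ) MeasureTheory.MeasureSpace.volume; let M : ℂ → ℂ := fun s => ∫ u : ℝ, G u * Complex.exp ((s - 1 / 2) * u); -(∫ t, ‖g t‖ ^ 2) ≤ (M 0 + M 1 + ((1 / (2 * Real.pi) : ℂ) * (∫ t : ℝ, M (1 / 2 + t * Complex.I) * ((Complex.digamma (1 / 4 + t / 2 * Complex.I)).re : ℂ)) - G 0 * (Real.log Real.pi : ℂ)) - ∑' n : ℕ, ((c n : ℝ) : ℂ) / (Real.sqrt n : ℂ) * (G (Real.log n) + G (-Real.log n))).re) →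
        ∀ n, c n = Λ n) :=
  Negative.coneMagnification_not_slackConeRigid_of_riemannHypothesis hRH

/-- **Single-prime deletions** (re-export): under RH, `Λ - η𝟙{n = p}` has unit slack against EVERY
Weil test whenever `0 ≤ η`, `2η ≤ √p`. For `p = 2` and all `p ≥ 79` this allows `η = log p` (the prime
deleted outright, prime powers kept); for `3 ≤ p ≤ 73` only `η ≤ √p/2 < log p`. The multi-prime form
`Λ - Σ ηₚ𝟙{n=p}` with `Σ 2ηₚ/√p ≤ 1` holds by the same one-line proof. [folklore] -/
theorem slackCone_sub_single (hRH : Summit.RiemannHypothesis) {p : ℕ} {η : ℝ} (hη : 0 ≤ η)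
    (hηp : 2 * η ≤ Real.sqrt p) :
    ∀ g : ℝ → ℂ, (ContDiff ℝ ((⊤ : ℕ∞) : WithTop ℕ∞) g ∧ HasCompactSupport g) → let G : ℝ → ℂ := MeasureTheory.convolution g (fun u => (starRingEnd ℂ) (g (-u))) (ContinuousLinearMap.mul ℂ ℂ) MeasureTheory.MeasureSpace.volume; let M : ℂ → ℂ := fun s => ∫ u : ℝ, G u * Complex.exp ((s - 1 / 2) * u); -(∫ t, ‖g t‖ ^ 2) ≤ (M 0 + M 1 + ((1 / (2 * Real.pi) : ℂ) * (∫ t : ℝ, M (1 / 2 + t * Complex.I) * ((Complex.digamma (1 / 4 + t / 2 * Complex.I)).re : ℂ)) - G 0 * (Real.log Real.pi : ℂ)) - ∑' n : ℕ, ((((Λ n : ℝ) - if n = p then η else 0 : ℝ) : ℝ) : ℂ) / (Real.sqrt n : ℂ) * (G (Real.log n) + G (-Real.log n))).re :=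
  Negative.coneMagnification_slackCone_sub_single_of_riemannHypothesis hRH hη hηp

/-- **The `ℓ¹(n^{-1/2})`-ball of radius `1/2` around `Λ`** (re-export of `SlackBall.lean`): under RH, for
any finitely supported `m` (any signs, any integers) with `Σ_{n∈S}|m(n)|/√n ≤ 1/2`, the weight `Λ + m` has
unit slack against every Weil test. [folklore] -/
theorem slackCone_ball (hRH : Summit.RiemannHypothesis) {m : ℕ → ℝ} (S : Finset ℕ)
    (hmS : ∀ n ∉ S, m n = 0) (hvar : ∑ n ∈ S, |m n| / Real.sqrt n ≤ 1 / 2) :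
    ∀ g : ℝ → ℂ, (ContDiff ℝ ((⊤ : ℕ∞) : WithTop ℕ∞) g ∧ HasCompactSupport g) → let G : ℝ → ℂ := MeasureTheory.convolution g (fun u => (starRingEnd ℂ) (g (-u))) (ContinuousLinearMap.mul ℂ ℂ) MeasureTheory.MeasureSpace.volume; let M : ℂ → ℂ := fun s => ∫ u : ℝ, G u * Complex.exp ((s - 1 / 2) * u); -(∫ t, ‖g t‖ ^ 2) ≤ (M 0 + M 1 + ((1 / (2 * Real.pi) : ℂ) * (∫ t : ℝ, M (1 / 2 + t * Complex.I) * ((Complex.digamma (1 / 4 + t / 2 * Complex.I)).re : ℂ)) - G 0 * (Real.log Real.pi : ℂ)) - ∑' n : ℕ, ((((Λ n : ℝ) + m n : ℝ) : ℝ) : ℂ) / (Real.sqrt n : ℂ) * (G (Real.log n) + G (-Real.log n))).re :=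
  Negative.coneMagnification_slackCone_of_variation_le_half hRH S hmS hvar

/-- **NEAR-MISS (sharpness of `√p/2`; the `K`-criterion, necessity half).** Claim: under RH, if
`Λ - η𝟙{n = p}` (`p` prime, `0 ≤ η ≤ log p`) has unit slack against every Weil test then `2η ≤ √p`.
Spectral form (Mellin inversion on the critical line, in-tree `weilMellin_inversion`,
`integral_norm_sq_weilMellin_half_line`): `Re(W_ar(G) - P_c(G)) + ‖g‖₂² = (1/2π)∫|ĝ(1/2+it)|² K_c(t) dt
+ Σ_γ m_γ |ĝ(1/2+iγ)|²` with `K_c(t) = 1 + (2η/√p) cos(t log p)`; if `2η > √p` then `K_c < 0` on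
intervals of length `≍ 1/log p` recurring with period `2π/log p`. OBSTRUCTION (why sorried): the zeros'
contribution `Σ_γ |ĝ(γ)|² ≥ 0` swamps any bounded negative density unless `|ĝ|²` is parked INSIDE a gap
between consecutive zeros lying in a negativity interval — a test of length `ℓ ≳ log t₀` at height `t₀`
with Gevrey decay of `ĝ` off `t₀`; needs (i) zero counting with gaps (`N(T)` asymptotics in-tree?
`Literature.NumberTheory.LFunctions.ZetaZeros`), (ii) a quantitative Paley–Wiener bump, (iii) the
spectral identity for `G(± log p)`. Tried: nothing formal this cycle (analysis only, §C of the module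
docstring). The same argument for a finitely supported modification `m` gives the torus criterion
`sup_θ Σ m(n) n^{-1/2} cos⟨v(n), θ⟩ ≤ 1/2` (Kronecker–Weyl for the phases `t log p`). -/
theorem slackCone_sub_single_only_if (hRH : Summit.RiemannHypothesis) {p : ℕ} (hp : p.Prime) {η : ℝ}
    (hη : 0 ≤ η) (hηlog : η ≤ Real.log p)
    (hcone : ∀ g : ℝ → ℂ, (ContDiff ℝ ((⊤ : ℕ∞) : WithTop ℕ∞) g ∧ HasCompactSupport g) → let G : ℝ → ℂ := MeasureTheory.convolution g (fun u => (starRingEnd ℂ) (g (-u))) (ContinuousLinearMap.mul ℂ ℂ) MeasureTheory.MeasureSpace.volume; let M : ℂ → ℂ := fun s => ∫ u : ℝ, G u * Complex.exp ((s - 1 / 2) * u); -(∫ t, ‖g t‖ ^ 2) ≤ (M 0 + M 1 + ((1 / (2 * Real.pi) : ℂ) * (∫ t : ℝ, M (1 / 2 + t * Complex.I) * ((Complex.digamma (1 / 4 + t / 2 * Complex.I)).re : ℂ)) - G 0 * (Real.log Real.pi : ℂ)) - ∑' n : ℕ, ((((Λ n : ℝ) - if n = p then η else 0 : ℝ) :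 ℝ) : ℂ) / (Real.sqrt n : ℂ) * (G (Real.log n) + G (-Real.log n))).re) :
    2 * η ≤ Real.sqrt p := by
  sorry

/-- **NEAR-MISS / PREDICTION (total prime variation `≤ 1`; a dual certificate for W-MAG Thm 1.2(i)).**
Claim: under RH, if `c ≥ 0` differs from `Λ` on a finite set and has unit slack against every Weil test,
then `Σ_{p ∈ S} |c(p) - log p| / √p ≤ 1` for every finite set `S` of primes — whatever `c` does at
composites and prime powers. HEURISTIC PROOF (torus form of the `K`-criterion, see
`slackCone_sub_single_only_if`): cone membership ⇒ `f(θ) := 1/2 - Σₙ (c-Λ)(n) n^{-1/2} cos⟨v(n),θ⟩ ≥ 0`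
on the torus of prime phases; integrate `f` against the DIAGONAL FEJÉR measure `θ_p = φ + π·𝟙{c(p) >
log p}`, `φ ∼ (1 - cos φ) dφ/2π`: its moments are `∓1/2` on the characters `v = e_p` and `0` on every
`v` with `|v| = Ω(n) ≥ 2` (composites AND prime powers drop out), giving
`0 ≤ ∫ f = 1/2 - ½ Σ_p |c(p) - log p|/√p`. Consequences if true: (hdef) of
`riemannHypothesis_of_fakeWeight_landau` for every `σ > 1/2` (prime powers add `Σ_p log p · p^{-2σ} <
∞`), with the clean constant `1` in place of 2001's `2M`; and `coneMagnification_tight_at_deficit_half`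
shows the constant is `≥ 1/2`. OBSTRUCTION (why sorried, and why 2001 needed a "resonator/type
inequality"): realising the torus point `θ` by an actual height `t` (Kronecker) forces `t ≍ e^{cK}` for
`K` controlled primes, positivity over the zeros then forces tests of length `ℓ ≍ C log t` (`1/2π ≪ C <
1`) parked in a zero gap, and such a test sees every `n ≤ t^{2C}` — far more primes than are
controlled; the uncontrolled tail has small mean over `t ∈ [T, 2T]` when `C < 1` but its correlation
with the head-phase event does not vanish (near-coincidences `|log n - Σ k_p log p| ≍ 1/n`, `n ≫ T`).
A prover attempting (hdef) should start from this dual certificate and look for a test family whose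
node profile imitates the Fejér diagonal average directly (resonator `g = Σ_{n ≤ N} r(n) b(x - log n)`
with completely multiplicative `r`, `|r(p)| < 1`: then `(g ⋆ g̃)(log m)` weights `m` by `Σ_n r(mn) r̄(n)`,
which IS multiplicative in `m` — the arithmetic analogue of the diagonal coupling). -/
theorem slackCone_prime_variation_le_one (hRH : Summit.RiemannHypothesis) {c : ℕ → ℝ}
    (hc : ∀ n, 0 ≤ c n) (hfin : (Function.support fun n => c n - Λ n).Finite)
    (hcone : ∀ g : ℝ → ℂ, (ContDiff ℝ ((⊤ : ℕ∞) : WithTop ℕ∞) g ∧ HasCompactSupport g) → let G : ℝ → ℂ := MeasureTheory.convolution g (fun u => (starRingEnd ℂ) (g (-u))) (ContinuousLinearMap.mul ℂ ℂ) MeasureTheory.MeasureSpace.volume; let M : ℂ → ℂ := fun s => ∫ u : ℝ, G u * Complex.exp ((s - 1 / 2) * u); -(∫ t, ‖g t‖ ^ 2) ≤ (M 0 + M 1 + ((1 / (2 * Real.pi) : ℂ) * (∫ t : ℝ, M (1 / 2 + t * Complex.I) * ((Complex.digamma (1 / 4 + t / 2 * Complex.I)).re : ℂ)) - G 0 * (Real.log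 Real.pi : ℂ)) - ∑' n : ℕ, ((c n : ℝ) : ℂ) / (Real.sqrt n : ℂ) * (G (Real.log n) + G (-Real.log n))).re)
    (S : Finset ℕ) (hS : ∀ p ∈ S, p.Prime) :
    ∑ p ∈ S, |c p - Real.log p| / Real.sqrt p ≤ 1 := by
  sorry

/-! ## §D Adversarial weights under `¬RH` (why the crux resists) -/

/-- **Catalogue of adversarial weights tried against W-MAG** (a `¬RH` world with an off-line zero
`ρ₀ = β₀ + iγ₀`; the adversary must keep `W_ar - P_c ≥ -‖g‖₂²` for ALL tests; `W_ar - P_c = W + P_{Λ-c}`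
with `W(G) = Σ_ρ Φ_G(ρ)` by `explicit_formula_holds`). Each line: weight ↦ the test that kills it.
1. `c = Λ` ↦ two-bump magnifier `g = e^{-iγ₀x}(k(x+T/2) - k(x-T/2))`: `W(G) ≈ -8Φₖ(β₀)Φₖ(1-β₀)
   sinh²((β₀-1/2)T/2)` against `O(log γ₀)‖g‖₂²` from nearby zeros ⇒ dies at `T ≍ log log γ₀/(β₀-1/2)`
   (this is W-EFFMAG's witness for the Λ-CONE; for the sign cone the witness must be node-nonnegative,
   see item SignConeOscillatory).
2. `c = Λ(1 + cos(γ₀ log n))` (absorb the zero by a twist) ↦ one-bump resonant test `G = e^{iγ₀x}K(x)`,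
   `K` wide: `P_c` picks the untwisted main term `½ Σ Λ(n) n^{-1/2} K(log n) ≍ e^{a}` (fake POLE at
   `1 + iγ₀`) while `W(G) = O(a)‖g‖₂²` ⇒ dies at every large cutoff.
3. quartet-cancelling `c = Λ + n^{ρ₀-1} + n^{ρ̄₀-1} + n^{-ρ₀} + n^{-ρ̄₀}` ↦ not admissible: `c < 0` at
   half of the composites (and, signed, its Dirichlet series meets `ζ(3/2-β₀+it)`, unbounded: previous
   seat's note).
4. positive repair `c = Λ + (n^{β₀-1} + n^{-β₀})(2 + 2cos(γ₀ log n))` ↦ same-sign two bumps at height 0,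
   `g = k(x+T/2) + k(x-T/2)`: the added mean density is a real anti-zero pair at `β₀, 1-β₀`, contributing
   `-4 Re Φ⁺_G(β₀) ≈ -4e^{(β₀-1/2)T}Φₖ(β₀)` against `W(G) = O(1)‖g‖₂²` ⇒ dies.
5. mean-corrected twist `c = Λ(1 + 2n^{β₀-1}cos(γ₀ log n))` (`≥ 0` for `n ≥ 2^{1/(1-β₀)}`): the pole of
   `-ζ'/ζ(s+1-ρ₀)` at `s = ρ₀` cancels the zero, but every zero `ρ` of `ζ` reappears shifted to
   `ρ + ρ₀ - 1` (real part `β₀ - 1/2 < 1/2`, NOT paired under `s ↦ 1 - s̄`) ↦ two-bump magnifier aimed at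
   height `γ + γ₀` gains `≍ e^{(1-β₀)T}` ⇒ dies (faster than the original zero could be exploited).
6. `Λ + ε`, `(1-ε)Λ + ε·1`, `0.9Λ`, `c ≡ 1`, `c = 2·𝟙{squares}` ↦ wrong residue at `s = 1` (wide positive
   bumps: `P_{c-Λ}` grows like `e^{a}`) or `K_c(t) = … - 2Re D̃_c(1/2+it) < 0` somewhere (`c ≡ 1`: first at
   `t ≈ 17.08`; previous seat, job j020144).
MECHANISM common to all deaths: `c ≥ 0` forces either the residue at `1` to be exactly `1` with
square-root-accurate twisted short sums `Σ_{n≈N}(c-Λ)(n)n^{-it} = O(√N·polylog)` (else one- or two-bump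
tests at the offending height win exponentially in the cutoff), or a compensating positive density whose
own Dirichlet series is evaluated INSIDE the strip (`ζ`, `ζ'/ζ` on `Re = 3/2 - β₀`), unbounded by
Bohr–Courant. This is the Landau/positivity pinch of W-MAG seen from the adversary's side; it corroborates
the crux without proving it. BARRIERS: DMV2006/Beurling not instantiable (integer nodes, exact Γ-data;
a density-1 sub-semigroup of ℕ keeps every prime); Davenport–Heilbronn, de Branges: not engaged. -/
theorem adversarialWeights_note : True := trivial

/-! ## §E Targets (lead's stuck stubs)

None registered yet (`payload.stuck_stubs = []`, no `PICKED.md`). When a line is picked, the natural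
first targets are the two open inputs of `riemannHypothesis_of_fakeWeight_landau` for a UNIFORM cone
weight `c` (`exists_uniform_fakeWeight`): (hcont) continuation of `D_c - 1/(s-1)` to thin rectangles in
`Re s > 1/2` — expected TRUE (Bochner–Schwartz, §D of the module docstring); (hdef) `Σ(Λ-c)₊ n^{-σ} < ∞`
for `σ > 1/2` — expected true but any version with an explicit constant `< 1/2` at `σ = 1/2`, or asserting
`c = Λ` on prime powers, is refuted above under RH.

PLANNED FOR CYCLE 2 (once a line is picked; one `kit` job): the cards' numerical falsifier as a
cutting-plane LP on the finite-cutoff cone `K♭_a`, `a = (log 210)/2` — variables `c(n)`, `n < 210`;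
constraints `Σ c(n)·2Re G(log n)/√n ≤ Re W_ar(G) + ‖g‖₂²` from one-bump / two-bump / resonator tests, the
separation oracle being "find a height `t ≤ 10⁵` in a zero gap where `1 - 2Re Σ (c-Λ)(n) n^{-1/2-it} < 0`
and add the narrowband test there"; objectives `min Σ_p c(p)/√p` (net prime deficit), windowed deficits,
`min c(2)`. It measures how much larger `K♭_a` is than the uniform cone and calibrates `WindowedDeficit` /
`AbscissaAsymmetry`; sanity check `c = Λ` feasible with margin `Re Q(g) ≥ 0`. -/

end Summit.RiemannHypothesis.RiemannHypothesis.Cruxes.ConeMagnification.Disproof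

end
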